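import Literature.Probability.RandomPlanarGeometry.HexSAW
import Mathlib.Analysis.SpecialFunctions.Complex.Arg
import HarnessLib

/-!
# The flow-line (imaginary-geometry) observable of the hexagonal self-avoiding walk

Topic `Literature/Probability/RandomPlanarGeometry`; definition request `defn-HexFlowLineObservable`
(route `CriticalPhenomena/SAWTurnDefect`, items `HexFlowLineMartingale` = stmt-CriticalPhenomena-7891,
`DefectIdentity` = stmt-CriticalPhenomena-7895, `KernelOrthogonality` = stmt-CriticalPhenomena-8295).
The file names, as definitions with bodies, the `let`s of those items, so that they unfold to the
filed signatures by `δ/ζ`-reduction.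

## (a) Discrete harmonic extension on hexagon centres

The hexagons of the honeycomb lattice `ℍ` are the vertices `Site 2` of its dual, the triangular
lattice `𝕋 = triGraph` (`TriangularLattice.lean`: `HexVertex` = faces of `𝕋` = vertices of `ℍ`,
`hexFaceVertices f` = the three hexagons around the honeycomb vertex `f`, `triEmbed y` = the centre
of the hexagon `y`).  Schramm–Sheffield, *Harmonic explorer and its convergence to SLE₄*, Ann.
Probab. 33 (2005), §3.1: "If `V₀` is any set of vertices in `V(TG)`, and `h : V₀ → ℝ` is a bounded
function, then there exists a unique bounded function `h̄ : V(TG) → ℝ` which agrees with `h` in `V₀`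
and is harmonic at every vertex in `V(TG) ∖ V₀`. This function is called the discrete harmonic
extension of `h`. [In fact, `h̄(v)` is the expected value of `h` at the point at which a simple
random walk started at `v` hits `V₀`.]"  With `S = V(TG) ∖ V₀`:

* `hexHarmonicExt S g y = Σ_{u} Σ_{w : y ⇝ u in 𝕋} 𝟙[w stays in S before its last vertex, u ∉ S]
  6^{-|w|} g u` — the path-sum form of `E^y[g(X_τ); τ < ∞]`, `τ` the exit time of simple random
  walk from `S` (exactly the `let H` of the three items);
* `hexHarmonicMeasure S v z = hexHarmonicExt (S ∖ {v}) 𝟙_{v} z` — the harmonic measure `ω^z(v)`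
  of the hexagon `v ∈ S` seen from `z` (`DefectIdentity`);
* `hexTiltedProb S f v f_R f_L = (hexHarmonicExt S f v - f_L)/(f_R - f_L)` — the tilted
  harmonic-explorer probability (Schramm–Sheffield's `p_{n+1}` = "the value at `v_{n+1}` of the
  discrete harmonic extension" is the case `f_L = 0`, `f_R = 1`).

API proved here: `hexHarmonicExt_eq_of_not_mem` (`= g` off `S`), `hexHarmonicExt_empty`,
`hexHarmonicExt_univ`, `hexHarmonicExt_const_mul` (homogeneity), `hexHarmonicExt_congr` (only
`g|_{Sᶜ}` matters).  Additivity in `g`, harmonicity on `S`, the maximum principle and the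
first-passage decomposition need the summability of the path sum (total mass `P^y(τ < ∞) ≤ 1`)
and are left to the route items (`DefectIdentity` is filed as provable-now).

## (b) The imaginary-geometry data along a hexagonal SAW

For a self-avoiding walk `γ` of `Ω_δ ⊆ δℍ` (`SAW.HexDomainSAW Ω δ a b`, Duminil-Copin–Smirnov 2012)
and a chordal uniformizer `φ : ℍₒ → Ω`, the `let`s of `HexFlowLineMartingale`, as dot-notation
definitions on `γ`: `pt` (the `s`-th honeycomb vertex), `flank s` (the two hexagons flanking the
dart `γ_s → γ_{s+1}`), `bank t` (hexagons flanking one of the first `t` darts), `firstFlank y`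
(first-determination index `s₀`), `imagePt φ s = φ⁻¹(δ·γ_s)`, `imageWinding φ s` (cumulative
`Complex.arg` of the image darts), `side y` (`-1` left / `+1` right of the first flanking dart),
`ConformalEquiv.realArcImage φ I` (boundary arc `φ(I)`, `I ⊆ ℝ`), `igData φ l χ t` (boundary
hexagons `∓1` by the nearer image arc of `ℝ₋/ℝ₊`, bank hexagons `side·l + χ(W_{s₀} - π/2)` — the
flow-line boundary rule of Miller–Sheffield, *Imaginary geometry I*, PTRF 164 (2016), Thm. 1.1,
heights divided by `λ`, so `χ/λ = 2/(3π)` at `κ = 8/3`), `hexInterior Ω δ` (hexagons all of whose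
honeycomb vertices lie in `Ω_δ`), `igObservable φ l χ t y = hexHarmonicExt (hexInterior ∖ bank t)
(igData t) y` (the observable `M_t(y)`), `stopIndex z₀ b' ρ` (first step `ρ`-close to `z₀` or `b'`,
else the length), and for `KernelOrthogonality`: `tipHexagons t`/`tipHexagon t` (the hexagon ahead
of the tip: in `hexFaceVertices γ_t` but not flanking dart `t-1`), `TurnsLeft t` (the tip hexagon
ends on the right of dart `t`), `tipHarmonicMeasure`, `tiltedExplorerProb`.

## References

* O. Schramm, S. Sheffield, *Harmonic explorer and its convergence to SLE₄*, Ann. Probab. 33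
  (2005), §1 (HE: "color `f` black with probability equal to the value at `f` of the function which
  is `1` on the black faces, `0` on the white faces, and is discrete harmonic at the undetermined
  faces"), §3.1 (discrete harmonic extension; `p_{n+1}`), Lemma 3.1 (martingale). [SchrammSheffield2005]
* J. Miller, S. Sheffield, *Imaginary geometry I: interacting SLEs*, PTRF 164 (2016), Thm. 1.1 and
  Fig. 1.9–1.10 (flow-line boundary data `±λ' + χ·winding`). [MillerSheffield2016]
* H. Duminil-Copin, S. Smirnov, Ann. of Math. 175 (2012), §4 (the SAW of `Ω_δ ⊆ δℍ`). [DuminilCopinSmirnov2012]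
* G. Lawler, V. Limic, *Random Walk: A Modern Introduction* (2010), §6.2 (Dirichlet problem,
  `F(x) = E^x[F(S_τ)]`). [LawlerLimic2010]
-/

noncomputable section

open MeasureTheory Filter Topology
open Literature.Probability.LatticeModels

namespace Literature.Probability.RandomPlanarGeometry

/-! ### (a) The discrete harmonic extension on hexagon centres (SRW on the triangular lattice) -/

section HarmonicExtension

open Classical in
/-- **Discrete harmonic extension on hexagon centres.** For `S ⊆ Site 2` (hexagons = vertices of
the triangular lattice `𝕋`), data `g` and a hexagon `y`:
`Σ_u Σ_{w : 𝕋-walk y → u} 𝟙[every vertex of w but the last lies in S ∧ u ∉ S] · 6^{-|w|} · g u`,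
i.e. `E^y[g(X_τ); τ < ∞]` for simple random walk `X` on `𝕋` (each of the six neighbours with
probability `1/6`) and `τ = inf {n ≥ 0 | X_n ∉ S}` — the walks counted are exactly the trajectories
up to the exit time.  For `y ∉ S` it is `g y` (`hexHarmonicExt_eq_of_not_mem`); Schramm–Sheffield's
"discrete harmonic extension of `h = g|_{V₀}`", `V₀ = Sᶜ` (bounded `g`; for `S` with
`P^y(τ < ∞) = 1`).  Written with iterated `tsum` exactly as the `let H` of route `SAWTurnDefect`.
[cite: SchrammSheffield2005, §3.1 (discrete harmonic extension)] -/
def hexHarmonicExt (S : Set (Site 2)) (g : Site 2 → ℝ) (y : Site 2) : ℝ :=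
  ∑' (u : Site 2), ∑' (w : triGraph.Walk y u),
    if (∀ q ∈ w.support.dropLast, q ∈ S) ∧ u ∉ S then (1 / 6 : ℝ) ^ w.length * g u else 0

/-- **Harmonic measure of a hexagon.** `ω^z_S(v) := hexHarmonicExt (S ∖ {v}) 𝟙_{v} z`: the
probability that simple random walk on hexagon centres from `z`, run until it first leaves
`S ∖ {v}`, does so at `v` (for `v ∈ S`: hits `v` before leaving `S`).  The weight `ω^z(v)` of
`DefectIdentity`. [cite: SchrammSheffield2005, §1 ("the probability that a random walk on faces, started at f, hits a black face before hitting a white face")] -/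
def hexHarmonicMeasure (S : Set (Site 2)) (v z : Site 2) : ℝ :=
  hexHarmonicExt (S \ {v}) (Set.indicator {v} 1) z

/-- **Tilted harmonic-explorer probability.** `(hexHarmonicExt S f v - f_L) / (f_R - f_L)`: the
probability of giving the hexagon `v` the value `f_R` (rather than `f_L`) that makes the expected
new datum equal to the current harmonic extension at `v` — Schramm–Sheffield's rule "`p_{n+1}` =
the value at `v_{n+1}` of the discrete harmonic extension" is the case `f_L = 0, f_R = 1`.  Junk
(division by zero) if `f_R = f_L`. [cite: SchrammSheffield2005, §3.1 (definition of p_{n+1})] -/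
def hexTiltedProb (S : Set (Site 2)) (f : Site 2 → ℝ) (v : Site 2) (fR fL : ℝ) : ℝ :=
  (hexHarmonicExt S f v - fL) / (fR - fL)

variable {S : Set (Site 2)} {g g' : Site 2 → ℝ} {y : Site 2}

/-- A non-trivial walk keeps its starting vertex among the vertices before the last. [folklore] -/
theorem start_mem_support_dropLast {V : Type*} {G : SimpleGraph V} {u v : V} (w : G.Walk u v)
    (hw : w.length ≠ 0) : u ∈ w.support.dropLast := by
  cases w with
  | nil => simp at hw
  | cons h w' =>
    rw [SimpleGraph.Walk.support_cons, List.dropLast_cons_of_ne_nil (SimpleGraph.Walk.support_ne_nil _)]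
    exact List.mem_cons_self

open Classical in
/-- The summand of `hexHarmonicExt` vanishes on every non-trivial walk from a point outside `S`
(such a walk has its first vertex, which is not in `S`, before its last). [folklore] -/
theorem hexHarmonicExt_summand_eq_zero_of_not_mem (hy : y ∉ S) {u : Site 2}
    (w : triGraph.Walk y u) (hw : w.length ≠ 0) :
    (if (∀ q ∈ w.support.dropLast, q ∈ S) ∧ u ∉ S then (1 / 6 : ℝ) ^ w.length * g u else 0) = 0 := by
  rw [if_neg]
  exact fun h ↦ hy (h.1 y (start_mem_support_dropLast w hw))

/-- **Off `S` the harmonic extension is the datum**: `hexHarmonicExt S g y = g y` for `y ∉ S`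
(the exit time is `0`; only the trivial walk contributes). Schramm–Sheffield: "`h̄` agrees with `h`
in `V₀`". [cite: SchrammSheffield2005, §3.1] -/
theorem hexHarmonicExt_eq_of_not_mem (hy : y ∉ S) : hexHarmonicExt S g y = g y := by
  classical
  unfold hexHarmonicExt
  rw [tsum_eq_single y]
  · rw [tsum_eq_single (SimpleGraph.Walk.nil : triGraph.Walk y y)]
    · simp [hy]
    · intro w hw
      exact hexHarmonicExt_summand_eq_zero_of_not_mem hy w
        fun h ↦ hw (SimpleGraph.Walk.eq_nil_iff_nil.mpr (SimpleGraph.Walk.length_eq_zero_iff.mp h))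
  · intro u hu
    refine (tsum_congr fun w ↦ ?_).trans tsum_zero
    exact hexHarmonicExt_summand_eq_zero_of_not_mem hy w fun h ↦ hu (w.eq_of_length_eq_zero h).symm

/-- With `S = ∅` (absorb immediately) the extension is `g` itself. [folklore] -/
@[simp] theorem hexHarmonicExt_empty (g : Site 2 → ℝ) (y : Site 2) : hexHarmonicExt ∅ g y = g y :=
  hexHarmonicExt_eq_of_not_mem (Set.notMem_empty y)

/-- With `S = univ` (never absorbed) the extension is `0`: no walk ends outside `S`. [folklore] -/
@[simp] theorem hexHarmonicExt_univ (g : Site 2 → ℝ) (y : Site 2) :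
    hexHarmonicExt Set.univ g y = 0 := by
  classical
  simp [hexHarmonicExt]

/-- **Homogeneity in the data**: `hexHarmonicExt S (c·g) = c · hexHarmonicExt S g` (no summability
needed). Schramm–Sheffield: "the harmonic extension is a linear operation". [cite: SchrammSheffield2005, §3.1 (proof of Lemma 3.1)] -/
theorem hexHarmonicExt_const_mul (c : ℝ) (S : Set (Site 2)) (g : Site 2 → ℝ) (y : Site 2) :
    hexHarmonicExt S (fun u ↦ c * g u) y = c * hexHarmonicExt S g y := by
  classical
  unfold hexHarmonicExt
  rw [← tsum_mul_left]
  refine tsum_congr fun u ↦ ?_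
  rw [← tsum_mul_left]
  refine tsum_congr fun w ↦ ?_
  split_ifs <;> ring

/-- **Only the data off `S` matter**: if `g = g'` on `Sᶜ` then the extensions agree (the summand
only evaluates `g` at endpoints `u ∉ S`). [folklore] -/
theorem hexHarmonicExt_congr (h : ∀ u, u ∉ S → g u = g' u) (y : Site 2) :
    hexHarmonicExt S g y = hexHarmonicExt S g' y := by
  classical
  unfold hexHarmonicExt
  refine tsum_congr fun u ↦ tsum_congr fun w ↦ ?_
  split_ifs with hc
  · rw [h u hc.2]
  · rfl

/-- Unfolding `hexHarmonicMeasure`. [folklore] -/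
theorem hexHarmonicMeasure_eq (S : Set (Site 2)) (v z : Site 2) :
    hexHarmonicMeasure S v z = hexHarmonicExt (S \ {v}) (Set.indicator {v} 1) z := rfl

/-- The harmonic measure of `v` seen from `v` itself is `1` (the walk is absorbed at time `0`). [folklore] -/
@[simp] theorem hexHarmonicMeasure_self (S : Set (Site 2)) (v : Site 2) : hexHarmonicMeasure S v v = 1 := by
  rw [hexHarmonicMeasure_eq, hexHarmonicExt_eq_of_not_mem (fun h ↦ h.2 rfl)]
  simp

/-- Seen from a point `z ∉ S`, `z ≠ v`, the harmonic measure of `v` is `0`. [folklore] -/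
theorem hexHarmonicMeasure_eq_zero_of_not_mem {S : Set (Site 2)} {v z : Site 2} (hz : z ∉ S)
    (hzv : z ≠ v) : hexHarmonicMeasure S v z = 0 := by
  rw [hexHarmonicMeasure_eq, hexHarmonicExt_eq_of_not_mem (fun h ↦ hz h.1)]
  simp [hzv]

/-- Unfolding `hexTiltedProb`. [folklore] -/
theorem hexTiltedProb_eq (S : Set (Site 2)) (f : Site 2 → ℝ) (v : Site 2) (fR fL : ℝ) :
    hexTiltedProb S f v fR fL = (hexHarmonicExt S f v - fL) / (fR - fL) := rfl

/-- The defining property of the tilted probability: `p f_R + (1 - p) f_L = hexHarmonicExt S f v`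
(the expected new datum is the current extension), for `f_R ≠ f_L`. [cite: SchrammSheffield2005, §3.1 (proof of Lemma 3.1: E[h_{n+1}(v_{n+1}) | …] = h_n(v_{n+1}))] -/
theorem hexTiltedProb_combination (S : Set (Site 2)) (f : Site 2 → ℝ) (v : Site 2) {fR fL : ℝ}
    (h : fR ≠ fL) :
    hexTiltedProb S f v fR fL * fR + (1 - hexTiltedProb S f v fR fL) * fL = hexHarmonicExt S f v := by
  rw [hexTiltedProb_eq]
  have : fR - fL ≠ 0 := sub_ne_zero.2 h
  field_simp
  ring

end HarmonicExtension

/-! ### Boundary arcs of a chordal uniformizer -/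

namespace ConformalEquiv

variable {U V : Set ℂ}

/-- The **image boundary arc** `φ(I)` of a set `I ⊆ ℝ ⊆ ∂ℍₒ` under (the boundary extension of) a
conformal map `φ : ℍₒ → Ω`: for a chordal uniformizer (`0 ↦ a`, `∞ ↦ b`), `φ(ℝ₋)` and `φ(ℝ₊)` are
the two boundary arcs of the Dobrushin domain `(Ω; a, b)` (Schramm–Sheffield: `ϕ(A₊) = (0,∞)`,
`ϕ(A₋) = (-∞,0)`). The `let arc` of `HexFlowLineMartingale`. [cite: SchrammSheffield2005, §3.2] -/
def realArcImage (φ : ConformalEquiv U V) (I : Set ℝ) : Set ℂ :=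
  φ.boundaryExtension '' {q : ℂ | q.im = 0 ∧ q.re ∈ I}

/-- Unfolding `realArcImage`. [folklore] -/
theorem realArcImage_eq (φ : ConformalEquiv U V) (I : Set ℝ) :
    φ.realArcImage I = φ.boundaryExtension '' {q : ℂ | q.im = 0 ∧ q.re ∈ I} := rfl

/-- `realArcImage` is monotone in the real set. [folklore] -/
theorem realArcImage_mono (φ : ConformalEquiv U V) {I J : Set ℝ} (h : I ⊆ J) :
    φ.realArcImage I ⊆ φ.realArcImage J :=
  Set.image_mono fun _ hq ↦ ⟨hq.1, h hq.2⟩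

end ConformalEquiv

/-! ### (b) Flow-line data along a hexagonal self-avoiding walk -/

/-- The **lattice interior** of `Ω` at mesh `δ` on the hexagon side: the hexagons `y` all of whose
(three per adjacent honeycomb vertex, six in all) honeycomb vertices `f ∋ y` lie in the discrete
domain `Ω_δ = embMeshDomain hexGraph hexCenter Ω δ` of Duminil-Copin–Smirnov. The `let Hex` of
`HexFlowLineMartingale`. [cite: DuminilCopinSmirnov2012, §4 (the domain Ω_δ)] -/
def hexInterior (Ω : Set ℂ) (δ : ℝ) : Set (Site 2) :=
  {y | ∀ f : HexVertex, y ∈ hexFaceVertices f → f ∈ SAW.embMeshDomain hexGraph hexCenter Ω δ}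

/-- Membership in `hexInterior`. [folklore] -/
theorem mem_hexInterior_iff {Ω : Set ℂ} {δ : ℝ} {y : Site 2} :
    y ∈ hexInterior Ω δ ↔
      ∀ f : HexVertex, y ∈ hexFaceVertices f → f ∈ SAW.embMeshDomain hexGraph hexCenter Ω δ :=
  Iff.rfl

namespace SAW.HexDomainSAW

variable {Ω : Set ℂ} {δ : ℝ} {a b : HexVertex}

/-- The `s`-th honeycomb vertex `γ_s` of the walk (`getVert`; constant `= b` beyond the length). [folklore] -/
def pt (γ : HexDomainSAW Ω δ a b) (s : ℕ) : HexVertex :=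
  γ.walk.getVert s

/-- `γ_0 = a`. [folklore] -/
@[simp] theorem pt_zero (γ : HexDomainSAW Ω δ a b) : γ.pt 0 = a := SimpleGraph.Walk.getVert_zero _

/-- `γ_{|γ|} = b`. [folklore] -/
@[simp] theorem pt_length (γ : HexDomainSAW Ω δ a b) : γ.pt γ.walk.length = b :=
  SimpleGraph.Walk.getVert_length _

/-- Beyond the length the walk stays at `b`. [folklore] -/
theorem pt_of_length_le (γ : HexDomainSAW Ω δ a b) {s : ℕ} (hs : γ.walk.length ≤ s) : γ.pt s = b :=
  SimpleGraph.Walk.getVert_of_length_le _ hs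

/-- The **flank** of the dart `s` (`γ_s → γ_{s+1}`): the hexagons containing both endpoints, i.e.
the two hexagons on either side of that honeycomb edge (`hexFaceVertices γ_s ∩ hexFaceVertices γ_{s+1}`,
of cardinality `2` for adjacent vertices by the definition of `hexGraph`). [folklore] -/
def flank (γ : HexDomainSAW Ω δ a b) (s : ℕ) : Finset (Site 2) :=
  hexFaceVertices (γ.pt s) ∩ hexFaceVertices (γ.pt (s + 1))

/-- Unfolding `flank`. [folklore] -/
theorem flank_eq (γ : HexDomainSAW Ω δ a b) (s : ℕ) :
    γ.flank s = hexFaceVertices (γ.pt s) ∩ hexFaceVertices (γ.pt (s + 1)) := rfl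

/-- The **bank** at time `t`: the hexagons flanking one of the darts `0, …, t-1` of `γ` (those whose
imaginary-geometry datum has been determined by time `t`). An `abbrev`, so that `Decidable (y ∈ bank t)`
is found by unfolding (as for the set-builder `let B` of the route, with which `igData` must agree
definitionally). [folklore] -/
abbrev bank (γ : HexDomainSAW Ω δ a b) (t : ℕ) : Set (Site 2) :=
  {y | ∃ s : ℕ, s < t ∧ s < γ.walk.length ∧ y ∈ γ.flank s}

/-- Membership in the bank. [folklore] -/
theorem mem_bank_iff (γ : HexDomainSAW Ω δ a b) {t : ℕ} {y : Site 2} :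
    y ∈ γ.bank t ↔ ∃ s : ℕ, s < t ∧ s < γ.walk.length ∧ y ∈ γ.flank s := Iff.rfl

/-- At time `0` nothing is determined. [folklore] -/
@[simp] theorem bank_zero (γ : HexDomainSAW Ω δ a b) : γ.bank 0 = ∅ := by
  ext y; simp

/-- The bank grows with time. [folklore] -/
theorem bank_mono (γ : HexDomainSAW Ω δ a b) : Monotone γ.bank :=
  fun _ _ hst _ ⟨s, hs, hl, hy⟩ ↦ ⟨s, hs.trans_le hst, hl, hy⟩

/-- The bank stops growing at the length of the walk. [folklore] -/
theorem bank_of_length_le (γ : HexDomainSAW Ω δ a b) {t : ℕ} (ht : γ.walk.length ≤ t) :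
    γ.bank t = γ.bank γ.walk.length :=
  Set.ext fun _ ↦ ⟨fun ⟨s, _, hl, hy⟩ ↦ ⟨s, hl, hl, hy⟩, fun ⟨s, _, hl, hy⟩ ↦ ⟨s, hl.trans_le ht, hl, hy⟩⟩

/-- A flanking hexagon of dart `s < |γ|` is in the bank from time `s + 1` on. [folklore] -/
theorem mem_bank_succ_of_mem_flank (γ : HexDomainSAW Ω δ a b) {s : ℕ} {y : Site 2}
    (hs : s < γ.walk.length) (hy : y ∈ γ.flank s) : y ∈ γ.bank (s + 1) :=
  ⟨s, Nat.lt_succ_self s, hs, hy⟩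

/-- The **first-determination index** `s₀(y)`: the first dart of `γ` flanked by the hexagon `y`
(`sInf`, junk `0` if `y` flanks no dart). [folklore] -/
def firstFlank (γ : HexDomainSAW Ω δ a b) (y : Site 2) : ℕ :=
  sInf {s : ℕ | s < γ.walk.length ∧ y ∈ γ.flank s}

/-- Unfolding `firstFlank`. [folklore] -/
theorem firstFlank_eq (γ : HexDomainSAW Ω δ a b) (y : Site 2) :
    γ.firstFlank y = sInf {s : ℕ | s < γ.walk.length ∧ y ∈ γ.flank s} := rfl

/-- A bank hexagon flanks the dart `s₀(y)`, and `s₀(y) < |γ|`. [folklore] -/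
theorem firstFlank_spec (γ : HexDomainSAW Ω δ a b) {t : ℕ} {y : Site 2} (hy : y ∈ γ.bank t) :
    γ.firstFlank y < γ.walk.length ∧ y ∈ γ.flank (γ.firstFlank y) := by
  obtain ⟨s, -, hl, hys⟩ := hy
  have hne : ({s : ℕ | s < γ.walk.length ∧ y ∈ γ.flank s} : Set ℕ).Nonempty := ⟨s, hl, hys⟩
  exact Nat.sInf_mem hne

/-- The first-determination index of a hexagon in the bank at time `t` is `< t`. [folklore] -/
theorem firstFlank_lt (γ : HexDomainSAW Ω δ a b) {t : ℕ} {y : Site 2} (hy : y ∈ γ.bank t) :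
    γ.firstFlank y < t := by
  obtain ⟨s, hst, hl, hys⟩ := hy
  have hmem : s ∈ ({s : ℕ | s < γ.walk.length ∧ y ∈ γ.flank s} : Set ℕ) := ⟨hl, hys⟩
  exact (Nat.sInf_le hmem).trans_lt hst

/-- The **image points** `P_s = φ⁻¹(δ · hexCenter γ_s) ∈ ℍₒ` of the walk under the inverse of the
uniformizer `φ : ℍₒ → Ω`. [folklore] -/
def imagePt (γ : HexDomainSAW Ω δ a b) (φ : ConformalEquiv UpperHalfPlane.upperHalfPlaneSet Ω)
    (s : ℕ) : ℂ :=
  φ.symm ((δ : ℂ) * hexCenter (γ.pt s))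

/-- Unfolding `imagePt`. [folklore] -/
theorem imagePt_eq (γ : HexDomainSAW Ω δ a b) (φ : ConformalEquiv UpperHalfPlane.upperHalfPlaneSet Ω)
    (s : ℕ) : γ.imagePt φ s = φ.symm ((δ : ℂ) * hexCenter (γ.pt s)) := rfl

/-- The **cumulative image winding** `W_s`: the argument of the first image dart plus the turning
angles (principal `Complex.arg` of the ratios of consecutive image darts) up to dart `s` — a
continuous determination of the direction of the `s`-th image dart `P_{s+1} - P_s` along the path
(Miller–Sheffield: flow-line heights change by `χ ·` winding). [cite: MillerSheffield2016, Thm. 1.1 and Fig. 1.10 (χ · winding)] -/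
def imageWinding (γ : HexDomainSAW Ω δ a b) (φ : ConformalEquiv UpperHalfPlane.upperHalfPlaneSet Ω)
    (s : ℕ) : ℝ :=
  Complex.arg (γ.imagePt φ 1 - γ.imagePt φ 0) +
    ∑ j ∈ Finset.range s, Complex.arg ((γ.imagePt φ (j + 2) - γ.imagePt φ (j + 1)) /
      (γ.imagePt φ (j + 1) - γ.imagePt φ j))

/-- `W_0` is the argument of the first image dart. [folklore] -/
@[simp] theorem imageWinding_zero (γ : HexDomainSAW Ω δ a b)
    (φ : ConformalEquiv UpperHalfPlane.upperHalfPlaneSet Ω) :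
    γ.imageWinding φ 0 = Complex.arg (γ.imagePt φ 1 - γ.imagePt φ 0) := by
  simp [imageWinding]

/-- `W_{s+1} = W_s +` the turning angle between image darts `s` and `s + 1`. [folklore] -/
theorem imageWinding_succ (γ : HexDomainSAW Ω δ a b)
    (φ : ConformalEquiv UpperHalfPlane.upperHalfPlaneSet Ω) (s : ℕ) :
    γ.imageWinding φ (s + 1) = γ.imageWinding φ s +
      Complex.arg ((γ.imagePt φ (s + 2) - γ.imagePt φ (s + 1)) /
        (γ.imagePt φ (s + 1) - γ.imagePt φ s)) := by
  simp [imageWinding, Finset.sum_range_succ, add_assoc]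

/-- The **side** of a hexagon `y` relative to its first flanking dart `γ_{s₀} → γ_{s₀+1}`: `-1` if
the centre `triEmbed y` lies to the LEFT of the dart (`Im( conj(dart) · (centre - start) ) > 0`),
`+1` otherwise (right; junk for hexagons flanking no dart). Left is negative as for flow-line
boundary data (Miller–Sheffield, Fig. 1.10: `-λ'` to the left, `+λ'` to the right of the path). [cite: MillerSheffield2016, Thm. 1.1 and Fig. 1.10] -/
def side (γ : HexDomainSAW Ω δ a b) (y : Site 2) : ℝ :=
  if 0 < ((starRingEnd ℂ) (hexCenter (γ.pt (γ.firstFlank y + 1)) - hexCenter (γ.pt (γ.firstFlank y))) *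
      (triEmbed y - hexCenter (γ.pt (γ.firstFlank y)))).im then -1 else 1

/-- The side function takes the values `±1`. [folklore] -/
theorem side_eq_neg_one_or_one (γ : HexDomainSAW Ω δ a b) (y : Site 2) : γ.side y = -1 ∨ γ.side y = 1 := by
  unfold side; split_ifs <;> simp

/-- `|side| = 1`. [folklore] -/
@[simp] theorem abs_side (γ : HexDomainSAW Ω δ a b) (y : Site 2) : |γ.side y| = 1 := by
  rcases γ.side_eq_neg_one_or_one y with h | h <;> simp [h]

open Classical in
/-- The **imaginary-geometry data** at time `t` with bank constant `l` and winding coefficient `χ`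
(`= χ/λ = 2/(3π)` at `κ = 8/3` in the route): a bank hexagon `y ∈ bank t` carries
`side(y) · l + χ · (W_{s₀(y)} - π/2)` (its datum frozen at first determination), any other
hexagon carries `-1` if `δ · triEmbed y` is at least as close to the image arc `φ(ℝ₋)` as to
`φ(ℝ₊)`, and `+1` otherwise (the two boundary arcs of the Dobrushin domain). Miller–Sheffield's
flow-line boundary rule, heights divided by `λ`. The `let dat` of `HexFlowLineMartingale`
(with `χ = 2/(3π)`). [cite: MillerSheffield2016, Thm. 1.1 (boundary data −λ' + χ·winding / λ' + χ·winding)] -/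
def igData (γ : HexDomainSAW Ω δ a b) (φ : ConformalEquiv UpperHalfPlane.upperHalfPlaneSet Ω)
    (l χ : ℝ) (t : ℕ) (y : Site 2) : ℝ :=
  if y ∈ γ.bank t then γ.side y * l + χ * (γ.imageWinding φ (γ.firstFlank y) - Real.pi / 2)
  else if Metric.infDist ((δ : ℂ) * triEmbed y) (φ.realArcImage (Set.Iic 0)) ≤
      Metric.infDist ((δ : ℂ) * triEmbed y) (φ.realArcImage (Set.Ici 0)) then -1 else 1

/-- The datum of a bank hexagon. [folklore] -/
theorem igData_of_mem_bank (γ : HexDomainSAW Ω δ a b)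
    (φ : ConformalEquiv UpperHalfPlane.upperHalfPlaneSet Ω) (l χ : ℝ) {t : ℕ} {y : Site 2}
    (hy : y ∈ γ.bank t) :
    γ.igData φ l χ t y = γ.side y * l + χ * (γ.imageWinding φ (γ.firstFlank y) - Real.pi / 2) := by
  classical
  exact if_pos hy

/-- The datum of a hexagon outside the bank is `±1` (boundary colouring by the nearer arc). [folklore] -/
theorem igData_of_not_mem_bank (γ : HexDomainSAW Ω δ a b)
    (φ : ConformalEquiv UpperHalfPlane.upperHalfPlaneSet Ω) (l χ : ℝ) {t : ℕ} {y : Site 2}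
    (hy : y ∉ γ.bank t) : γ.igData φ l χ t y = -1 ∨ γ.igData φ l χ t y = 1 := by
  classical
  unfold igData; rw [if_neg hy]; split_ifs <;> simp

/-- Bank data are frozen: for `y ∈ bank t` and `t ≤ t'` the datum at time `t'` is the datum at
time `t`. [folklore] -/
theorem igData_eq_of_mem_bank (γ : HexDomainSAW Ω δ a b)
    (φ : ConformalEquiv UpperHalfPlane.upperHalfPlaneSet Ω) (l χ : ℝ) {t t' : ℕ} (htt' : t ≤ t')
    {y : Site 2} (hy : y ∈ γ.bank t) : γ.igData φ l χ t' y = γ.igData φ l χ t y := by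
  rw [γ.igData_of_mem_bank φ l χ hy, γ.igData_of_mem_bank φ l χ (γ.bank_mono htt' hy)]

/-- The **flow-line (IG) observable** `M_t(y) := hexHarmonicExt (hexInterior Ω δ ∖ bank t) (igData t) y`:
the discrete harmonic extension, to the undetermined interior hexagons, of the data determined by
time `t` (bank data along the walk, `∓1` on the two boundary arcs) — the hexagonal-SAW analogue of
Schramm–Sheffield's `h_n(v)` (Lemma 3.1: a martingale for the harmonic explorer) with the
imaginary-geometry boundary rule. The `let M` of `HexFlowLineMartingale`. [cite: SchrammSheffield2005, §1 and Lemma 3.1 (h_n)] -/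
def igObservable (γ : HexDomainSAW Ω δ a b) (φ : ConformalEquiv UpperHalfPlane.upperHalfPlaneSet Ω)
    (l χ : ℝ) (t : ℕ) (y : Site 2) : ℝ :=
  hexHarmonicExt (hexInterior Ω δ \ γ.bank t) (γ.igData φ l χ t) y

/-- Unfolding `igObservable`. [folklore] -/
theorem igObservable_eq (γ : HexDomainSAW Ω δ a b)
    (φ : ConformalEquiv UpperHalfPlane.upperHalfPlaneSet Ω) (l χ : ℝ) (t : ℕ) (y : Site 2) :
    γ.igObservable φ l χ t y = hexHarmonicExt (hexInterior Ω δ \ γ.bank t) (γ.igData φ l χ t) y := rfl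

/-- Off the undetermined set the observable is the datum: for `y ∈ bank t` or `y ∉ hexInterior`,
`M_t(y) = igData t y`. [folklore] -/
theorem igObservable_eq_igData (γ : HexDomainSAW Ω δ a b)
    (φ : ConformalEquiv UpperHalfPlane.upperHalfPlaneSet Ω) (l χ : ℝ) {t : ℕ} {y : Site 2}
    (hy : y ∉ hexInterior Ω δ \ γ.bank t) : γ.igObservable φ l χ t y = γ.igData φ l χ t y :=
  hexHarmonicExt_eq_of_not_mem hy

/-- The **stopping index** `T`: the first step `t` at which the rescaled tip `δ · hexCenter γ_t` is
within `ρ` of the interior point `z₀` or of the boundary point `b'` (the marked point `b`), and the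
length of the walk if this never happens (`sInf` of the union with `{|γ|}`). The `let T` of
`HexFlowLineMartingale`. [folklore] -/
def stopIndex (γ : HexDomainSAW Ω δ a b) (z₀ b' : ℂ) (ρ : ℝ) : ℕ :=
  sInf ({t : ℕ | dist ((δ : ℂ) * hexCenter (γ.pt t)) z₀ < ρ ∨ dist ((δ : ℂ) * hexCenter (γ.pt t)) b' < ρ} ∪
    {γ.walk.length})

/-- The stopping index is at most the length. [folklore] -/
theorem stopIndex_le_length (γ : HexDomainSAW Ω δ a b) (z₀ b' : ℂ) (ρ : ℝ) :
    γ.stopIndex z₀ b' ρ ≤ γ.walk.length :=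
  Nat.sInf_le (Set.mem_union_right _ rfl)

/-- The **hexagons ahead of the tip** at step `t`: the hexagons at the honeycomb vertex `γ_t` that do
not flank the incoming dart `t - 1` (a singleton for `1 ≤ t ≤ |γ|`: of the three hexagons at `γ_t`,
two flank the edge `γ_{t-1}γ_t`; all three at `t = 0`). Schramm–Sheffield's `v_{n+1}`, "the vertex
of `T_{n+1}` which is not on the edge containing" the current tip. [cite: SchrammSheffield2005, §3.1 (v_{n+1})] -/
def tipHexagons (γ : HexDomainSAW Ω δ a b) (t : ℕ) : Finset (Site 2) :=
  hexFaceVertices (γ.pt t) \ γ.flank (t - 1)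

/-- Unfolding `tipHexagons`. [folklore] -/
theorem tipHexagons_eq (γ : HexDomainSAW Ω δ a b) (t : ℕ) :
    γ.tipHexagons t = hexFaceVertices (γ.pt t) \ γ.flank (t - 1) := rfl

/-- The tip hexagons are hexagons at the tip vertex. [folklore] -/
theorem tipHexagons_subset (γ : HexDomainSAW Ω δ a b) (t : ℕ) :
    γ.tipHexagons t ⊆ hexFaceVertices (γ.pt t) :=
  Finset.sdiff_subset

open Classical in
/-- The **hexagon ahead of the tip** `v_t`: the unique element of `tipHexagons t` when that set is a
singleton (junk: the cell corner of `γ_t` otherwise). [cite: SchrammSheffield2005, §3.1 (v_{n+1})] -/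
def tipHexagon (γ : HexDomainSAW Ω δ a b) (t : ℕ) : Site 2 :=
  if h : ∃ v, γ.tipHexagons t = {v} then h.choose else (γ.pt t).1

/-- When the tip hexagons form a singleton `{v}`, the tip hexagon is `v`. [folklore] -/
theorem tipHexagon_eq_of_eq_singleton (γ : HexDomainSAW Ω δ a b) {t : ℕ} {v : Site 2}
    (h : γ.tipHexagons t = {v}) : γ.tipHexagon t = v := by
  classical
  have hex : ∃ v, γ.tipHexagons t = {v} := ⟨v, h⟩
  rw [tipHexagon, dif_pos hex]
  exact Finset.singleton_injective (hex.choose_spec.symm.trans h)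

/-- **The walk turns left at step `t`**: the hexagon ahead of the tip ends up on the RIGHT of the
outgoing dart `γ_t → γ_{t+1}` (`Im( conj(dart) · (centre - γ_t) ) < 0`, the sign convention of
`side`). The indicator `L_t` of `KernelOrthogonality`. [folklore] -/
def TurnsLeft (γ : HexDomainSAW Ω δ a b) (t : ℕ) : Prop :=
  ((starRingEnd ℂ) (hexCenter (γ.pt (t + 1)) - hexCenter (γ.pt t)) *
      (triEmbed (γ.tipHexagon t) - hexCenter (γ.pt t))).im < 0

/-- The **harmonic measure of the tip hexagon** from `y` at time `t`, in the undetermined region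
`hexInterior Ω δ ∖ bank t`: `ω^y_t(v_t)`. [cite: SchrammSheffield2005, §1] -/
def tipHarmonicMeasure (γ : HexDomainSAW Ω δ a b) (t : ℕ) (y : Site 2) : ℝ :=
  hexHarmonicMeasure (hexInterior Ω δ \ γ.bank t) (γ.tipHexagon t) y

/-- The **tilted-harmonic-explorer probability** at step `t` for candidate data `f_R, f_L` of the
tip hexagon: `(M_t(v_t) - f_L)/(f_R - f_L)` — the probability of a left turn (tip hexagon to the
right, datum `f_R`) that would make `M_t(v_t)` a one-step martingale (Schramm–Sheffield's rule with
general two-point data). [cite: SchrammSheffield2005, §3.1 (p_{n+1}) and Lemma 3.1] -/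
def tiltedExplorerProb (γ : HexDomainSAW Ω δ a b)
    (φ : ConformalEquiv UpperHalfPlane.upperHalfPlaneSet Ω) (l χ : ℝ) (t : ℕ) (fR fL : ℝ) : ℝ :=
  hexTiltedProb (hexInterior Ω δ \ γ.bank t) (γ.igData φ l χ t) (γ.tipHexagon t) fR fL

/-- Unfolding `tiltedExplorerProb` in terms of the observable at the tip hexagon. [folklore] -/
theorem tiltedExplorerProb_eq (γ : HexDomainSAW Ω δ a b)
    (φ : ConformalEquiv UpperHalfPlane.upperHalfPlaneSet Ω) (l χ : ℝ) (t : ℕ) (fR fL : ℝ) :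
    γ.tiltedExplorerProb φ l χ t fR fL =
      (γ.igObservable φ l χ t (γ.tipHexagon t) - fL) / (fR - fL) := rfl

end SAW.HexDomainSAW

end Literature.Probability.RandomPlanarGeometry
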